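import Summits.BirchSwinnertonDyer.BirchSwinnertonDyer.Theorems.ByReductionTypeAtTwoSupersingularOrderTwoChar
import Summits.BirchSwinnertonDyer.Rank1Residual.Supersingular.BlindInterpolationFlatTwo
import HarnessLib

/-!
# Route `ByReductionTypeAtTwo` (rung K4), crux `SupersingularRankZeroAtTwo` (item
# stmt-BirchSwinnertonDyer-19097): the ODD-SIGN MIRROR at the order-2 character — `ξ⁻(−2) = 0`
# whenever `w_E · χ₈(N_E) = −1` (seat `bsd-2adic-ss-1`, GEN 5; companion of
# `ByReductionTypeAtTwoSupersingularOrderTwoChar.lean`, p451734)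

HONEST FRAMING (cell `bsd-2adic`, run/shared/lean/pub/bsd-2adic/, HUMAN RULINGS D-0036/D-0059/D-0074):
THEOREMS ONLY; the research input is the ODD-sign Eisenstein half `KobayashiLowerDivisibility W 2 (−1)`
(the tree's typed leaf; it is the lower binder of the odd-sign door
`supersingularRankZeroAtTwo_of_oddSignedHalves_two`, p443795 — NOT a registered stub of line
`signed_halves_two`, whose sign is `+`); no definition, no named fact, no `sorry`; nothing booked; BSD
is not proved by any of this. PARTITION (D-0054): X5@2 good-ss (B1·O1; a₂ = 0 sub-row 208/757 r0
classes: 133 with `χ₈(N) = −1`, 75 with `χ₈(N) = +1` — eng-2 TABLE-SS-E2) × p = 2 —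
types-the-object-of; closes none. bears_on: K4 (route-BirchSwinnertonDyer-ByReductionTypeAtTwo item 19097).

## What is proved

The companion file transports the tree's forced zero of the EVEN-sign function, `L♭(−2) = 0` when
`w_E·χ₈(N_E) = +1`, through `KobayashiLowerDivisibility W 2 1`. Here the ODD sign: the tree knows
`L♯(−2) = −2([1/8]⁺_f − [5/8]⁺_f)` for every Sprung pair at `2` (`coe_evalAt_sharp_neg_two_eq`) and
`θ₁(f)(−2) = 2([1/8]⁺_f − [5/8]⁺_f) = 0` when `σ·χ₈(N) = −1` (`eval_neg_two_mazurTateElement_one`,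
`eval_neg_two_mazurTateElement_eq_zero` — the sign of `E ⊗ χ₈` is `−1`, a genuine central zero
`L(E ⊗ χ₈, 1) = 0`), hence `L♯(−2) = 0`; `L♯ = kobayashiL (−1)` is the odd-sign function. So:

* `evalAt_neg_two_charGenerator_eq_zero_of_kobayashiLowerDivisibility_two_negOne` — `E = W` good at
  `2`, `a₂ = 0`, `w_E·χ₈(N_E) = −1`, `KobayashiLowerDivisibility W 2 (−1)` ⇒ every generator of
  `char X⁻(E/ℚ_∞)` of every dual datum of `Sel⁻(E/ℚ_∞)` vanishes at `T = −2` (`(T+2) ∣ char X⁻`).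
* `…_of_rankZero` — on the crux's domain (`w_E = +1` unconditionally): the condition is `χ₈(N_E) = −1`,
  `N_E ≡ ±3 (mod 8)` (133 of the 208 `a₂ = 0` classes).
* `negOneKobayashiLower_prediction_orderTwoChar` — CLASS LEVEL with the odd Eisenstein half as a
  class hypothesis (the shape of p443795's `hlow`).

TOGETHER WITH p451734: on the `a₂ = 0` sub-row of the crux's domain the two signed Eisenstein halves
at `2` predict a zero at the order-2 character of EXACTLY ONE of `X⁺`, `X⁻`, selected by `N_E mod 8`
(`+` for `N ≡ ±1`, `−` for `N ≡ ±3`). For the odd sign the mechanism is transparent — `E⁻(k₁) = E(k₁)`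
(no odd `m < 1` in Kobayashi's Def. 1.1), so at `χ₈` the minus condition is the Kummer condition of
`E^{(2)}` and `Sel⁻[T+2] ≈ Sel_{2^∞}(E^{(2)}/ℚ)`, infinite because `w(E^{(2)}) = −1` forces
`L(E^{(2)},1) = 0` and (GZK at order `1`, or the `2`-parity theorem) positive corank; for the even sign
it is the transverse-Lagrangian parity flip (companion file, docstring). Analytic shadow, two-engine
(eng-2 CERT-SS-E2): `θ₁(−2) = 0` on 133/133 classes with `χ₈(N) = −1`, `λ♯` odd `≥ 3` there; `λ♭` odd
`≥ 3` on the 75 with `χ₈(N) = +1` (the tree theorems `neg_one_pow_lam_sharp/flat_two`). Nothing of this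
paragraph beyond the displayed theorems is asserted in the kernel.

References: S. Kobayashi, Invent. Math. 152 (2003) Def. 1.1, Conjecture p. 2 [Kobayashi2003];
F. Sprung, ANT 11 (2017) Thm. 1.12, Cor. 4.4 [Sprung2017]; B. Mazur, J. Tate, J. Teitelbaum, Invent.
Math. 84 (1986) §I.13, §I.17 [MazurTateTeitelbaum1986Invent]; J. H. Silverman, AEC (2009) C.16
[SilvermanAEC2009]; H. Darmon, CBMS 101 (2004) (2.13)–(2.17) [Darmon2004].
-/

set_option autoImplicit false
-- the Theorems namespace of this sub repeats the summit name by design (D-0017 nested layout)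
set_option linter.dupNamespace false

noncomputable section

open scoped Classical MatrixGroups ModularForm

open CongruenceSubgroup WeierstrassCurve Literature.NumberTheory.EllipticCurves
  Literature.NumberTheory.EllipticCurves.ModularForms Literature.NumberTheory.EllipticCurves.Sprung2017
  Literature.NumberTheory.EllipticCurves.Rank1Residual Literature.NumberTheory.EllipticCurves.Rank1Residual.Typed
  Literature.NumberTheory.EllipticCurves.Kobayashi2003 ZpExtension
  Summit.BirchSwinnertonDyer.Rank1Residual Summit.BirchSwinnertonDyer.Rank1Residual.Supersingular
  Summit.BirchSwinnertonDyer.Rank1Residual.Supersingular.BlindLever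

namespace Summit.BirchSwinnertonDyer.BirchSwinnertonDyer.Theorems

section OddSign

variable (W : WeierstrassCurve ℚ) [W.IsElliptic] [W.IsGloballyMinimal]

/-- **THE ODD-SIGN MIRROR AT THE ORDER-2 CHARACTER.** `E = W` with good reduction at `2`, `a₂ = 0`,
and `w_E · χ₈(N_E) = −1`; assume the odd Eisenstein half `KobayashiLowerDivisibility W 2 (−1)`
(`char X⁻ = (g₀)`, `ι g₀ = ϖ·ι(L♯·h)`). Then every generator `g` of `char X⁻(E/ℚ_∞)` of every dual
datum of `Sel⁻(E/ℚ_∞)` has `g(−2) = 0`. Proof: `L♯(−2) = −2([1/8]⁺ − [5/8]⁺)`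
(`coe_evalAt_sharp_neg_two_eq`; at `2`, `a₂ = 0`, the Pollack pair is a Sprung pair with `a = 0`) and
`θ₁(−2) = 2([1/8]⁺ − [5/8]⁺) = 0` (`eval_neg_two_mazurTateElement_eq_zero`, the Fricke sign read off
the root number as in `BlindFlat.flatLaw_evalAt_neg_two_of_rootNumber`), so `L♯(−2) = 0`; then clear
`ϖ`'s denominator and evaluate (`C_den_mul_eq_C_num_mul_of_iwasawaToPowerSeries_eq`, `evalAt_mul`).
[cite: Kobayashi2003, Conjecture (p. 2) and Def. 1.1] [cite: Sprung2017, Thm. 1.12 and Cor. 4.4]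
[cite: MazurTateTeitelbaum1986Invent, §I.13 and §I.17] [cite: Darmon2004, (2.13)–(2.17)] -/
theorem evalAt_neg_two_charGenerator_eq_zero_of_kobayashiLowerDivisibility_two_negOne
    (hgood : W.HasGoodReductionAtPrime 2) (ha : W.frobeniusTrace 2 = 0)
    (hsign : W.rootNumber * ZMod.χ₈ (W.conductorNorm ℤ : ZMod 8) = -1)
    (hlow : KobayashiLowerDivisibility W 2 (-1))
    (κ : ZpExtension ℚ 2) (γ : Field.absoluteGaloisGroup ℚ)
    (hκ : κ.IsCyclotomic) (hγ : κ.IsTopGenerator γ) (hγ' : IsCyclotomicVariable 2 γ)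
    [NeZero (W.conductorNorm ℤ)] (f : CuspForm (Gamma0 (W.conductorNorm ℤ)) 2) (hf : IsNewformOf W f)
    (ϖ : ℚ) (hϖ : (ϖ : ℝ) * W.realPeriodRat = plusPeriod f)
    (Lplus Lminus : IwasawaAlgebra 2) (hPP : IsPollackPair f 2 Lplus Lminus)
    (D : SignedSelmerDualData W κ γ (-1)) (g : IwasawaAlgebra 2) (hg : D.charIdeal = Ideal.span {g}) :
    evalAt (-2 : ℤ_[2]) g = 0 := by
  have ht : ‖(-2 : ℤ_[2])‖ < 1 := norm_neg_two_lt_one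
  obtain ⟨g₀, h, hchar, hι⟩ := hlow κ γ hκ hγ hγ' f hf ϖ hϖ Lplus Lminus hPP D
  have hkL : kobayashiL (-1 : ℤˣ) Lplus Lminus = Lplus := by
    unfold kobayashiL
    rw [if_neg (by decide)]
  rw [hkL] at hι
  have hSP : IsSprungPair f 2 (W.frobeniusTrace 2) Lplus Lminus := by
    rw [ha]
    exact (isSprungPair_zero_iff f 2 Lplus Lminus).mpr ⟨hPP.2.2.1, hPP.2.2.2⟩
  have hN2 : ¬ 2 ∣ W.conductorNorm ℤ := not_dvd_level_of_isNewformOf hf hgood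
  -- `L♯(−2) = −2([1/8]⁺ − [5/8]⁺)`
  have hval := coe_evalAt_sharp_neg_two_eq hf.1 hf.coeffField_eq_bot hN2
    (cuspCoeff_eq_frobeniusTrace_of_isNewformOf_holds hf hgood) (by rw [ha]; exact dvd_zero 2) hSP
  -- the Fricke sign from the root number, and the forced zero `θ₁(−2) = 0`
  have hw : (W.rootNumber : ℂ) = -frickeEigenvalue f :=
    rootNumber_eq_neg_frickeEigenvalue (fun _ _ ↦ IsNewform0.exists_functional_equation_holds)
      (fun _ _ ↦ IsNewform0.frickeEigenvalue_eq_one_or_eq_neg_one_holds) hf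
  have hsm := IsNewform0.frickeInvolution_eq_smul_holds (N := W.conductorNorm ℤ) (k := (2 : ℤ)) hf.1
  have hFE : IsFrickeEigen (W.conductorNorm ℤ) f (frickeEigenvalue f) :=
    isFrickeEigen_of_frickeInvolution_eq_smul _ hsm
  have hWf : IsFrickeEigen (W.conductorNorm ℤ) f (-((W.rootNumber : ℤ) : ℂ)) := by
    rw [hw, neg_neg]
    exact hFE
  have hθ := eval_neg_two_mazurTateElement_eq_zero W.rootNumber_eq_one_or hWf hN2 (le_refl 1) hsign
  rw [eval_neg_two_mazurTateElement_one] at hθ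
  have hS : ratPlusSymbol f ((1 : ℚ) / 8) - ratPlusSymbol f ((5 : ℚ) / 8) = 0 :=
    (mul_eq_zero.mp hθ).resolve_left (by norm_num)
  have hLp : evalAt (-2 : ℤ_[2]) Lplus = 0 := by
    have h0 : ((evalAt (-2 : ℤ_[2]) Lplus : ℤ_[2]) : ℚ_[2]) = 0 := by
      rw [hval, hS]
      push_cast
      ring
    have h0' : ((evalAt (-2 : ℤ_[2]) Lplus : ℤ_[2]) : ℚ_[2]) = ((0 : ℤ_[2]) : ℚ_[2]) := by
      rw [h0, PadicInt.coe_zero]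
    exact Subtype.coe_injective h0'
  -- transport through the odd Eisenstein half
  have hint := C_den_mul_eq_C_num_mul_of_iwasawaToPowerSeries_eq hι
  have hev := congrArg (evalAt (-2 : ℤ_[2])) hint
  rw [evalAt_mul ht, evalAt_C, evalAt_mul ht, evalAt_C, evalAt_mul ht, hLp, zero_mul,
    mul_zero] at hev
  have hden : ((ϖ.den : ℤ) : ℤ_[2]) ≠ 0 := by
    exact_mod_cast (Rat.den_pos ϖ).ne'
  have hg₀ : evalAt (-2 : ℤ_[2]) g₀ = 0 := (mul_eq_zero.mp hev).resolve_left hden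
  have hassoc : Associated g₀ g := Ideal.span_singleton_eq_span_singleton.mp (hchar.symm.trans hg)
  obtain ⟨u, hu⟩ := hassoc
  rw [← hu, evalAt_mul ht, hg₀, zero_mul]

/-- **On the crux's domain** (analytic rank `0`, so `w_E = +1` unconditionally): `a₂ = 0`,
`χ₈(N_E) = −1` (`N_E ≡ ±3 (mod 8)`), `KobayashiLowerDivisibility W 2 (−1)` ⇒ every generator of
`char X⁻(E/ℚ_∞)` vanishes at `T = −2`. [cite: SilvermanAEC2009, C.16 Thm. 16.3]
[cite: Kobayashi2003, Conjecture (p. 2)] [cite: Sprung2017, Thm. 1.12 and Cor. 4.4] -/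
theorem evalAt_neg_two_charGenerator_eq_zero_of_kobayashiLowerDivisibility_two_negOne_of_rankZero
    (hgood : W.HasGoodReductionAtPrime 2) (ha : W.frobeniusTrace 2 = 0) (hr : W.analyticRank = 0)
    (hχ : ZMod.χ₈ (W.conductorNorm ℤ : ZMod 8) = -1)
    (hlow : KobayashiLowerDivisibility W 2 (-1))
    (κ : ZpExtension ℚ 2) (γ : Field.absoluteGaloisGroup ℚ)
    (hκ : κ.IsCyclotomic) (hγ : κ.IsTopGenerator γ) (hγ' : IsCyclotomicVariable 2 γ)
    [NeZero (W.conductorNorm ℤ)] (f : CuspForm (Gamma0 (W.conductorNorm ℤ)) 2) (hf : IsNewformOf W f)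
    (ϖ : ℚ) (hϖ : (ϖ : ℝ) * W.realPeriodRat = plusPeriod f)
    (Lplus Lminus : IwasawaAlgebra 2) (hPP : IsPollackPair f 2 Lplus Lminus)
    (D : SignedSelmerDualData W κ γ (-1)) (g : IwasawaAlgebra 2) (hg : D.charIdeal = Ideal.span {g}) :
    evalAt (-2 : ℤ_[2]) g = 0 := by
  have hw : W.rootNumber = 1 := W.rootNumber_eq_one_of_even_analyticRank (by rw [hr]; exact ⟨0, rfl⟩)
  exact evalAt_neg_two_charGenerator_eq_zero_of_kobayashiLowerDivisibility_two_negOne W hgood ha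
    (by rw [hw, one_mul, hχ]) hlow κ γ hκ hγ hγ' f hf ϖ hϖ Lplus Lminus hPP D g hg

end OddSign

/-- **CLASS LEVEL (odd sign).** If the odd Eisenstein half `KobayashiLowerDivisibility W 2 (−1)`
holds on the `a₂ = 0` sub-row of the crux's domain (the `hlow` binder shape of the odd-sign door,
p443795), then on its `χ₈(N_E) = −1` part every characteristic power series of `X⁻(E/ℚ_∞)` vanishes at
`T = −2`. [cite: Kobayashi2003, Conjecture (p. 2) and Def. 1.1] [cite: Sprung2017, Thm. 1.12 and Cor. 4.4]
[cite: SilvermanAEC2009, C.16 Thm. 16.3] -/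
theorem negOneKobayashiLower_prediction_orderTwoChar
    (hlow : ∀ (W : WeierstrassCurve ℚ) [W.IsElliptic] [W.IsGloballyMinimal],
      ¬ W.HasCM → W.analyticRank = 0 → GoodSS W 2 → W.frobeniusTrace 2 = 0 →
        KobayashiLowerDivisibility W 2 (-1)) :
    ∀ (W : WeierstrassCurve ℚ) [W.IsElliptic] [W.IsGloballyMinimal],
      ¬ W.HasCM → W.analyticRank = 0 → GoodSS W 2 → W.frobeniusTrace 2 = 0 →
      ZMod.χ₈ (W.conductorNorm ℤ : ZMod 8) = -1 →
      ∀ (κ : ZpExtension ℚ 2) (γ : Field.absoluteGaloisGroup ℚ),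
        κ.IsCyclotomic → κ.IsTopGenerator γ → IsCyclotomicVariable 2 γ →
      ∀ [NeZero (W.conductorNorm ℤ)] (f : CuspForm (Gamma0 (W.conductorNorm ℤ)) 2),
        IsNewformOf W f → ∀ (ϖ : ℚ), (ϖ : ℝ) * W.realPeriodRat = plusPeriod f →
      ∀ (Lplus Lminus : IwasawaAlgebra 2), IsPollackPair f 2 Lplus Lminus →
      ∀ (D : SignedSelmerDualData W κ γ (-1)) (g : IwasawaAlgebra 2), D.charIdeal = Ideal.span {g} →
        evalAt (-2 : ℤ_[2]) g = 0 :=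
  fun W _ _ hcm hr hss ha hχ κ γ hκ hγ hγ' _ f hf ϖ hϖ Lp Lm hPP D g hg ↦
    evalAt_neg_two_charGenerator_eq_zero_of_kobayashiLowerDivisibility_two_negOne_of_rankZero W hss.1
      ha hr hχ (hlow W hcm hr hss ha) κ γ hκ hγ hγ' f hf ϖ hϖ Lp Lm hPP D g hg

end Summit.BirchSwinnertonDyer.BirchSwinnertonDyer.Theorems

end
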